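import Summits.NavierStokesRegularity.NavierStokesRegularity.Theorems.TypeILiouvilleTypeIliouvilleLOseenGauge
import Summits.NavierStokesRegularity.NavierStokesRegularity.Theorems.TypeILiouvilleTypeIliouvilleLStubOseenBallAverageMomentum
import Summits.NavierStokesRegularity.NavierStokesRegularity.Theorems.TypeILiouvilleTypeIliouvilleLStubOseenConstBoost
import Literature.Analysis.FluidPDE.KNSSGradientBoundWindowEnd
import Literature.Analysis.FluidPDE.BoundedMildSmoothRemainder
import Literature.Analysis.FluidPDE.ElgindiBlowup
import Literature.Analysis.FluidPDE.NSBoundedMildSmoothing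
import Literature.Analysis.FluidPDE.SelfSimilar
import HarnessLib

/-!
# Type-I velocity ⇒ Type-I vorticity for bounded ancient mild solutions
# (`NetFlux.TypeIVorticityBound` of the netflux line on crux `PoloidalLiouville`, stmt-NavierStokesRegularity-1222)

Support file for crux `PoloidalLiouville` (wall W1; line «netflux-typei-gap» of planner ns-idea-14,
`Cruxes/PoloidalLiouville/NetFluxTransportSketch.lean`, support Prop (NF-2) `NetFlux.TypeIVorticityBound`).
Experiment cell ARM A `pub/ns-exp-scalarLiouville` (D-0160), generation g3.  Theorems only; no definitions,
no named facts; nothing here proves `PoloidalLiouville`, `stub_scalarLiouville` or Navier–Stokes regularity.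

THE STATEMENT (body of the sketch's `NetFlux.TypeIVorticityBound` VERBATIM, here `PoloidalLiouville.NetFlux.typeIVorticityBound`): for a bounded ancient
mild solution `v` of Navier–Stokes (`ν = 1`, the tree's duality class
`Literature.Analysis.FluidPDE.IsBoundedAncientMildSolution`) which is smooth on `(−∞,0) × ℝ³` and Type I in
time, `‖v(t,x)‖ ≤ C/√(−t)` (`HasTypeITimeDecay C v`), there is `C₁` with `‖curl v(t,x)‖ ≤ C₁/(−t)` for all
`t < 0`, `x` (Koch–Nadirashvili–Seregin–Šverák 2009, (1.4) ⇒ the scale-invariant gradient bound, §4 (4.6)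
and §6).

THE PROOF (all inputs in the tree).
1. Oseen gauge (`oseen_gauge_of_aestronglyMeasurable`, line `registered` of crux `TypeIliouvilleL`):
   `v(t) = w(t, · − A(t)) + c(t)` a.e., with `w` a bounded continuous Oseen-mild field; both sides are
   continuous, so the identity holds everywhere (`Continuous.ae_eq_iff_eq`).  Hence `‖w(σ,y) + c(σ)‖ ≤ C/√(−σ)`.
2. Momentum at spatial infinity (`stub_oseen_ball_average_momentum`): `⨍_{B_R}(w(t) − w(s)) → 0`, whence the
   parasitic drift moves little: `‖c(t) − c(s)‖ ≤ C/√(−t) + C/√(−s)` (`NetFlux.norm_drift_sub_le`).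
3. Constant Galilean boost by `c(t⋆)` (`stub_oseen_const_boost`): `w⋆(σ,y) = w(σ, y − σ c(t⋆)) + c(t⋆)` is
   Oseen-mild and `‖w⋆‖ ≤ 5C/√(−t⋆)` on `[2t⋆, t⋆/2] × ℝ³`.
4. KNSS (4.6) at the end of the window (`isKNSSDriftMild_clamp_of_oseenForward`,
   `exists_norm_fderiv_le_sq_of_isKNSSDriftMild`) with `N = (5C + √ε)/√(−t⋆)` on the window of length
   `−3t⋆/2`, read at `t⋆` (elapsed `−t⋆`, `N²(−t⋆) ≥ ε`): `‖∇w⋆(t⋆)‖ ≤ C_K N²`; and `v(t⋆)` is a translate of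
   `w⋆(t⋆)`, so `‖curl v(t⋆,x)‖ ≤ 4‖∇v(t⋆,x)‖ ≤ 4C_K(5C + √ε)²/(−t⋆)` (`norm_curl_le_four_mul`).

## References
* G. Koch, N. Nadirashvili, G. Seregin, V. Šverák, Acta Math. 203 (2009) 83–105 = arXiv:0709.3599, §1 (1.4),
  §4 Prop. 4.1 with (4.6), §6. [KochNadirashviliSereginSverak2009]
* planner ns-idea-14, `Cruxes/PoloidalLiouville/NetFluxTransportSketch.lean` (NF-2); `pub/ns-exp-scalarLiouville/STATUS.md`.
-/

-- the summit and its single problem share the name (D-0017 nested layout)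
set_option linter.dupNamespace false

noncomputable section

namespace Summit.NavierStokesRegularity.NavierStokesRegularity.Theorems

open MeasureTheory Filter Set Function Metric
open scoped Topology ENNReal
open Literature.Analysis Literature.Analysis.FluidPDE Literature.Analysis.UnboundedOperators

namespace PoloidalLiouville.NetFlux

/-- **Momentum at infinity pins the parasitic drift.**  If `w` is a jointly measurable Oseen-mild field on
`(−∞,0) × ℝ³`, bounded by `K`, and `‖w(σ,y) + c(σ)‖ ≤ C/√(−σ)` for all `σ < 0`, `y` (the gauge image
`w(σ, · − A(σ)) + c(σ)` is Type I), then `‖c(t) − c(s)‖ ≤ C/√(−t) + C/√(−s)` for `s < t < 0`: the ball averages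
`⨍_{B_R}(w(t) − w(s))` tend to `0` (`stub_oseen_ball_average_momentum`) while each `⨍_{B_R} w(σ)` is within
`C/√(−σ)` of `−c(σ)`. -/
theorem norm_drift_sub_le {w : ℝ → EuclideanSpace ℝ (Fin 3) → EuclideanSpace ℝ (Fin 3)}
    {c : ℝ → EuclideanSpace ℝ (Fin 3)} {K C s t : ℝ}
    (hwm : Measurable (uncurry w)) (hK : ∀ σ < 0, ∀ y, ‖w σ y‖ ≤ K)
    (hmild : ∀ s t : ℝ, s < t → t < 0 → ∀ x,
      w t x = heatExtension (w s) (t - s) x - oseenDuhamel 1 s w w t x)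
    (hclose : ∀ σ < 0, ∀ y, ‖w σ y + c σ‖ ≤ C / Real.sqrt (-σ))
    (hst : s < t) (ht : t < 0) :
    ‖c t - c s‖ ≤ C / Real.sqrt (-t) + C / Real.sqrt (-s) := by
  have hs : s < 0 := hst.trans ht
  set B : ℝ := C / Real.sqrt (-t) + C / Real.sqrt (-s) with hB
  -- momentum at infinity
  have hm := stub_oseen_ball_average_momentum w K s t hst hwm
    (fun σ hσ y => hK σ (lt_of_le_of_lt hσ.2 ht) y)
  have hm' : Tendsto (fun R : ℝ => ⨍ x in ball (0 : EuclideanSpace ℝ (Fin 3)) R, (w t x - w s x))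
      atTop (𝓝 0) := by
    refine hm.congr fun R => ?_
    refine setAverage_congr_fun measurableSet_ball (Eventually.of_forall fun x _ => ?_)
    rw [hmild s t hst ht x]
    abel
  -- the error field `e = (w t + c t) − (w s + c s)` is bounded by `B`
  have hwt : Measurable (w t) := hwm.comp measurable_prodMk_left
  have hws : Measurable (w s) := hwm.comp measurable_prodMk_left
  have he : ∀ x, ‖(w t x + c t) - (w s x + c s)‖ ≤ B := fun x =>
    (norm_sub_le _ _).trans (add_le_add (hclose t ht x) (hclose s hs x))
  -- for every `R > 0`: `‖c t − c s‖ ≤ ‖⨍_{B_R}(w t − w s)‖ + B`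
  have key : ∀ R : ℝ, 0 < R →
      ‖c t - c s‖ ≤ ‖⨍ x in ball (0 : EuclideanSpace ℝ (Fin 3)) R, (w t x - w s x)‖ + B := by
    intro R hR
    set S : Set (EuclideanSpace ℝ (Fin 3)) := ball 0 R with hS
    have hSlt : volume S < ∞ := measure_ball_lt_top
    have hSpos : 0 < volume S := measure_ball_pos volume _ hR
    have hμ : 0 < volume.real S := ENNReal.toReal_pos hSpos.ne' hSlt.ne
    have hconst : IntegrableOn (fun _ : EuclideanSpace ℝ (Fin 3) => c s - c t) S volume :=
      integrableOn_const hSlt.ne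
    have herr : IntegrableOn (fun x => (w t x + c t) - (w s x + c s)) S volume :=
      Measure.integrableOn_of_bounded (M := B) hSlt.ne
        (((hwt.add_const _).sub (hws.add_const _)).aestronglyMeasurable)
        (ae_of_all _ fun x => he x)
    have hsplit : (fun x => w t x - w s x) =
        fun x => (c s - c t) + ((w t x + c t) - (w s x + c s)) := by
      funext x; abel
    have havg : ⨍ x in S, (w t x - w s x) =
        (c s - c t) + (volume.real S)⁻¹ • ∫ x in S, ((w t x + c t) - (w s x + c s)) := by
      rw [hsplit, setAverage_eq, integral_add hconst herr, setIntegral_const, smul_add, ← smul_assoc,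
        smul_eq_mul, inv_mul_cancel₀ hμ.ne', one_smul]
    have hint : ‖(volume.real S)⁻¹ • ∫ x in S, ((w t x + c t) - (w s x + c s))‖ ≤ B := by
      rw [norm_smul, norm_inv, Real.norm_of_nonneg hμ.le]
      have h1 := norm_setIntegral_le_of_norm_le_const hSlt (fun x _ => he x)
        (f := fun x => (w t x + c t) - (w s x + c s)) (μ := volume)
      calc (volume.real S)⁻¹ * ‖∫ x in S, ((w t x + c t) - (w s x + c s))‖
          ≤ (volume.real S)⁻¹ * (B * volume.real S) := by gcongr
        _ = B := by field_simp
    have hcs : c s - c t = (⨍ x in S, (w t x - w s x))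
        - (volume.real S)⁻¹ • ∫ x in S, ((w t x + c t) - (w s x + c s)) := by
      rw [havg]; abel
    calc ‖c t - c s‖ = ‖c s - c t‖ := norm_sub_rev _ _
      _ ≤ ‖⨍ x in S, (w t x - w s x)‖
          + ‖(volume.real S)⁻¹ • ∫ x in S, ((w t x + c t) - (w s x + c s))‖ := by
            rw [hcs]; exact norm_sub_le _ _
      _ ≤ _ := by gcongr
  -- let `R → ∞`
  have hlim : Tendsto (fun R : ℝ => ‖⨍ x in ball (0 : EuclideanSpace ℝ (Fin 3)) R, (w t x - w s x)‖ + B)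
      atTop (𝓝 (‖(0 : EuclideanSpace ℝ (Fin 3))‖ + B)) :=
    hm'.norm.add tendsto_const_nhds
  rw [norm_zero, zero_add] at hlim
  exact ge_of_tendsto hlim (Filter.eventually_atTop.2 ⟨1, fun R hR => key R (by linarith)⟩)

/-- **Type-I velocity ⇒ Type-I vorticity** (the body of `NetFlux.TypeIVorticityBound`, NF-2 of the netflux line
on crux `PoloidalLiouville`, VERBATIM): a bounded ancient mild solution of Navier–Stokes (`ν = 1`, duality class)
which is smooth on `(−∞,0) × ℝ³` and satisfies `‖v(t,x)‖ ≤ C/√(−t)` has `‖curl v(t,x)‖ ≤ C₁/(−t)` for one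
constant `C₁` and all `t < 0`, `x`.  Here `C₁ = 4C_K(5C + √ε)²` with the universal `ε, C_K` of KNSS 2009 (4.6)
at the end of the smoothing window (`exists_norm_fderiv_le_sq_of_isKNSSDriftMild`); route = Oseen gauge +
momentum at infinity + constant Galilean boost + (4.6), module docstring.
[cite: KochNadirashviliSereginSverak2009, (1.4), Prop. 4.1 with (4.6), §6 (arXiv:0709.3599v1 pp. 2, 8, 12)] -/
theorem typeIVorticityBound :
    ∀ (v : ℝ → EuclideanSpace ℝ (Fin 3) → EuclideanSpace ℝ (Fin 3)) (C : ℝ),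
      IsBoundedAncientMildSolution 1 v → HasTypeITimeDecay C v →
      ContDiffOn ℝ (⊤ : ℕ∞) (uncurry v) (Iio 0 ×ˢ univ) →
      ∃ C₁ : ℝ, ∀ t < 0, ∀ x, ‖curl (v t) x‖ ≤ C₁ / (-t) := by
  intro u C hB hT hsm
  -- ### Step 0: slices are continuous, hence a.e.-strongly measurable; `0 ≤ C`
  have huc : ∀ t < 0, Continuous (u t) := fun t ht =>
    hsm.continuousOn.comp_continuous (continuous_const.prodMk continuous_id) fun y =>
      mk_mem_prod (mem_Iio.2 ht) (mem_univ y)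
  have hmeas : ∀ t < 0, AEStronglyMeasurable (u t) volume := fun t ht =>
    (huc t ht).aestronglyMeasurable
  have hC : 0 ≤ C := by
    have h := hT (-1) (by norm_num) 0
    rw [neg_neg, Real.sqrt_one, div_one] at h
    exact (norm_nonneg _).trans h
  -- ### Step 1: the Oseen gauge, everywhere
  obtain ⟨w, A, c, hwm, hwc, ⟨K, hK⟩, hwd, hwmild, -, hrep⟩ :=
    oseen_gauge_of_aestronglyMeasurable u hB hmeas
  have hwsl : ∀ σ < 0, Continuous (w σ) := fun σ hσ =>
    hwc.comp_continuous (continuous_const.prodMk continuous_id) fun y =>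
      mk_mem_prod (mem_Iio.2 hσ) (mem_univ y)
  have hrep' : ∀ t < 0, u t = fun x => w t (x - A t) + c t := fun t ht =>
    (Continuous.ae_eq_iff_eq volume (huc t ht)
      (((hwsl t ht).comp (continuous_id.sub continuous_const)).add continuous_const)).1 (hrep t ht)
  -- the gauge field is `C/√(−σ)`-close to the constant `−c(σ)`
  have hclose : ∀ σ < 0, ∀ y, ‖w σ y + c σ‖ ≤ C / Real.sqrt (-σ) := by
    intro σ hσ y
    have h := congrFun (hrep' σ hσ) (y + A σ)
    simp only [add_sub_cancel_right] at h
    rw [← h]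
    exact hT σ hσ _
  -- ### the universal constants of KNSS (4.6) at the window end
  obtain ⟨ε, hε, CK, hCK, HK⟩ := exists_norm_fderiv_le_sq_of_isKNSSDriftMild
  refine ⟨4 * (CK * (5 * C + Real.sqrt ε) ^ 2), fun t ht x => ?_⟩
  have ht0 : 0 < -t := by linarith
  have hst : 0 < Real.sqrt (-t) := Real.sqrt_pos.2 ht0
  -- ### Step 3: constant boost by `c t`
  obtain ⟨hbc, -, hbd, hbmild⟩ := stub_oseen_const_boost w (-c t) hwc ⟨K, hK⟩ hwd hwmild
  set wb : ℝ → EuclideanSpace ℝ (Fin 3) → EuclideanSpace ℝ (Fin 3) :=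
    fun σ y => w σ (y + σ • -c t) - -c t with hwb
  -- its Type-I-size bound on the window `[2t, t/2]`
  have hwin : ∀ σ : ℝ, 2 * t ≤ σ → σ ≤ t / 2 → ∀ y,
      ‖wb σ y‖ ≤ (5 * C + Real.sqrt ε) / Real.sqrt (-t) := by
    intro σ h1 h2 y
    have hσ : σ < 0 := by linarith
    have hsσ : 0 < Real.sqrt (-σ) := Real.sqrt_pos.2 (by linarith)
    -- `C/√(−σ) ≤ 2C/√(−t)` since `−t ≤ 4(−σ)`
    have hcmp : C / Real.sqrt (-σ) ≤ 2 * C / Real.sqrt (-t) := by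
      have hsq : (Real.sqrt (-t) / 2) ^ 2 ≤ -σ := by
        rw [div_pow, Real.sq_sqrt ht0.le]; linarith
      have hle : Real.sqrt (-t) / 2 ≤ Real.sqrt (-σ) :=
        (le_abs_self _).trans (Real.abs_le_sqrt hsq)
      rw [show 2 * C / Real.sqrt (-t) = C / (Real.sqrt (-t) / 2) by field_simp]
      exact div_le_div_of_nonneg_left hC (by positivity) hle
    -- drift increment
    have hdrift : ‖c t - c σ‖ ≤ C / Real.sqrt (-t) + C / Real.sqrt (-σ) := by
      rcases lt_trichotomy σ t with hlt | heq | hgt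
      · exact norm_drift_sub_le hwm hK hwmild hclose hlt ht
      · rw [heq, sub_self, norm_zero]; positivity
      · rw [norm_sub_rev, add_comm]
        exact norm_drift_sub_le hwm hK hwmild hclose hgt hσ
    have hval : wb σ y = (w σ (y + σ • -c t) + c σ) + (c t - c σ) := by
      simp only [hwb]; abel
    calc ‖wb σ y‖ ≤ ‖w σ (y + σ • -c t) + c σ‖ + ‖c t - c σ‖ := by
          rw [hval]; exact norm_add_le _ _
      _ ≤ C / Real.sqrt (-σ) + (C / Real.sqrt (-t) + C / Real.sqrt (-σ)) :=
          add_le_add (hclose σ hσ _) hdrift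
      _ ≤ 2 * C / Real.sqrt (-t) + (C / Real.sqrt (-t) + 2 * C / Real.sqrt (-t)) := by
          gcongr
      _ = 5 * C / Real.sqrt (-t) := by ring
      _ ≤ (5 * C + Real.sqrt ε) / Real.sqrt (-t) := by
          gcongr; linarith [Real.sqrt_nonneg ε]
  -- ### Step 4: the translated window field and KNSS (4.6)
  set a : ℝ := 2 * t with ha
  set S : ℝ := -(3 * t / 2) with hS
  have hS0 : 0 < S := by rw [hS]; linarith
  set N : ℝ := (5 * C + Real.sqrt ε) / Real.sqrt (-t) with hN
  set wa : ℝ → EuclideanSpace ℝ (Fin 3) → EuclideanSpace ℝ (Fin 3) := fun τ => wb (τ + a) with hwa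
  have hτneg : ∀ τ ∈ Icc (0 : ℝ) S, τ + a < 0 := fun τ hτ => by
    rw [ha]; rw [hS] at hτ; linarith [hτ.2]
  have hcont_a : ContinuousOn (uncurry wa) (Icc 0 S ×ˢ univ) := by
    have hmap : Continuous fun p : ℝ × EuclideanSpace ℝ (Fin 3) => (p.1 + a, p.2) :=
      (continuous_fst.add continuous_const).prodMk continuous_snd
    have hinto : MapsTo (fun p : ℝ × EuclideanSpace ℝ (Fin 3) => (p.1 + a, p.2))
        (Icc (0 : ℝ) S ×ˢ univ) (Iio 0 ×ˢ univ) := by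
      rintro ⟨τ, y⟩ ⟨hτ, -⟩
      exact ⟨hτneg τ hτ, mem_univ _⟩
    exact (hbc.comp hmap.continuousOn hinto).congr fun p _ => rfl
  have hbound_a : ∀ τ ∈ Icc (0 : ℝ) S, ∀ y, ‖wa τ y‖ ≤ N := fun τ hτ y => by
    show ‖wb (τ + a) y‖ ≤ N
    rw [hS] at hτ
    exact hwin (τ + a) (by rw [ha]; linarith [hτ.1]) (by rw [ha]; linarith [hτ.2]) y
  have hdiv_a : ∀ τ ∈ Icc (0 : ℝ) S, IsWeaklyDivFree (wa τ) := fun τ hτ => hbd (τ + a) (hτneg τ hτ)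
  have hmild_a : ∀ s' τ : ℝ, 0 ≤ s' → s' < τ → τ ≤ S → ∀ y,
      wa τ y = heatExtension (wa s') (τ - s') y - oseenDuhamel 1 s' wa wa τ y := by
    intro s' τ hs' hs'τ hτS y
    have hτa : τ + a < 0 := hτneg τ ⟨hs'.trans hs'τ.le, hτS⟩
    have h := hbmild (s' + a) (τ + a) (by linarith) hτa y
    rw [hwa, oseenDuhamel_translate 1 s' a wb wb τ y]
    rw [show τ + a - (s' + a) = τ - s' by ring] at h
    exact h
  have hV := isKNSSDriftMild_clamp_of_oseenForward hS0 hcont_a hbound_a hdiv_a hmild_a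
  -- read (4.6) at the window time `τ₀ = −t` (physical time `t`)
  have hτ0 : -t ∈ Ioo 0 S := ⟨ht0, by rw [hS]; linarith⟩
  have hN2 : N ^ 2 = (5 * C + Real.sqrt ε) ^ 2 / (-t) := by
    rw [hN, div_pow, Real.sq_sqrt ht0.le]
  have hεN : ε ≤ N ^ 2 * (-t) := by
    rw [hN2, div_mul_cancel₀ _ ht0.ne']
    have h1 : Real.sqrt ε ≤ 5 * C + Real.sqrt ε := by linarith
    calc ε = Real.sqrt ε ^ 2 := (Real.sq_sqrt hε.le).symm
      _ ≤ (5 * C + Real.sqrt ε) ^ 2 := by gcongr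
  have hclamp : max 0 (min (-t) S) = -t := by
    rw [min_eq_left hτ0.2.le, max_eq_right ht0.le]
  have hgrad : ∀ z, ‖fderiv ℝ (wb t) z‖ ≤ CK * N ^ 2 := by
    intro z
    have h := HK hV (-t) hτ0 hεN z
    have hfun : (fun y => wa (max 0 (min (-t) S)) y) = wb t := by
      funext y
      rw [hclamp, hwa]
      show wb (-t + a) y = wb t y
      rw [show -t + a = t by rw [ha]; ring]
    simpa only [hfun] using h
  -- ### Step 5: `u t` is a translate of `wb t`
  set d : EuclideanSpace ℝ (Fin 3) := t • c t - A t with hd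
  have hut : u t = fun x => wb t (x + d) := by
    rw [hrep' t ht]
    funext x
    simp only [hwb, hd, smul_neg, sub_neg_eq_add]
    congr 1
    abel
  have hfd : fderiv ℝ (u t) x = fderiv ℝ (wb t) (x + d) := by
    rw [hut, fderiv_comp_add_right]
  calc ‖curl (u t) x‖ ≤ 4 * ‖fderiv ℝ (u t) x‖ := norm_curl_le_four_mul _ _
    _ ≤ 4 * (CK * N ^ 2) := by rw [hfd]; gcongr; exact hgrad _
    _ = 4 * (CK * (5 * C + Real.sqrt ε) ^ 2) / (-t) := by
        rw [hN2]; field_simp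

end PoloidalLiouville.NetFlux

end Summit.NavierStokesRegularity.NavierStokesRegularity.Theorems

end
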